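import Literature.NumberTheory.Automorphic.UnitaryCurveCotangentSpectralProjection
import HarnessLib

/-!
# Rank two: the spectral-projection letters (D₂)⁺ ∕ (D₂)⁻ APPLIED AT HERMITIAN `σ_{w(ι)}H` — `holCotFormSpectralProjection₂.apply_herm`,
# `antiholCotFormSpectralProjection₂.apply_herm`

Topic `NumberTheory/Automorphic`; namespace `Literature.NumberTheory.Automorphic.UnitaryCurveForms`.  PROOF FILE over ★
`UnitaryCurveCotangentSpectralProjection` (the two named facts (D₂) `holCotFormSpectralProjection₂` ∕ `antiholCotFormSpectralProjection₂`): two theorems,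
no definition, no named fact, no instance, no notation, no `sorry`.

WHAT.  `holCotFormSpectralProjection₂.apply_herm hD L ι H dV … t ht g hg hH hsig hpos h4 𝔣 μ P f hfmem hf` is the conclusion of the letter (D₂)⁺ for the datum
`(L, ι, H, dV, t, g, 𝔣, μ, P, f)` — «the orthogonal projection onto the discrete `P` of the class of the square-integrable cone-holomorphic cotangent form
`f` is the class of a square-integrable cone-holomorphic cotangent form `f′`» — with the hypotheses listed explicitly and ONE MORE than the letter
quantifies over: `hH : (H.map (cmPlace L ι).1.embedding).IsHermitian`.  Likewise `antiholCotFormSpectralProjection₂.apply_herm` for (D₂)⁻ (values in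
`(holCotForms₂ … 𝔣).map (conjFun₂ …)`).

WHY (normalisation of the scalar `t`; cell `hodgecm-mathlib`, floor-0 programme P5, desk ruling R1 (α-lite) 2026-08-31T02:17:57Z).  The letters quantify
over `(t : L) (_ : t ≠ 0) (g : GL₂ L)` with `formCongr c g (t • H) = diagonal dV`, `dV` real.  Writing `e := (cmPlace L ι).1.embedding` and
`K := e(g)⁻ᴴ · diagonal (e dV) · e(g)⁻¹` (hermitian of signature `(1,1)`), the hypothesis reads `e(t) • σ_e H = K`, so `σ_e H = e(t)⁻¹ • K` is HERMITIAN iff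
`e(t) ∈ ℝ` iff `c t = t`: for `t ∉ L⁺` the letters as first typed also speak about non-hermitian `H`, which no source states in that form
([BorelJacquet1979, §4.6] concerns the unitary group of a HERMITIAN form, [PlatonovRapinchuk1994, §2.3]) and which no consumer needs — every consumer
holds `0 < (ι t).re ∧ (ι t).im = 0`, under which `σ_e H` is hermitian.  The two theorems here are the letters' APPLICATION AT HERMITIAN `σ_e H`: every
consumer applies the letter through them (passing its hermitian witness), and their proofs are written so as to elaborate BOTH against the letters as first
typed (the extra hypothesis is then simply not consumed) AND against the letters with the binder `(H.map (cmPlace L ι).1.embedding).IsHermitian` inserted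
after the diagonalisation hypothesis (the honest statement, at which the analytic sub-line `Summits/…/Cruxes/HLiu418/Lines/F0_P5TP2SpectralProjection.lean`
proves (D₂)⁺): `apply hD L ι H dV hdV hdV0 t ht g hg` followed by `assumption` on every remaining hypothesis.  So the letter can be sharpened in place with no
consumer changing statement or proof.

READING of the statements: as in ★ `UnitaryCurveCotangentSpectralProjection` — `pr_P` is `U(H)(𝔸_{L⁺})`-equivariant ([BorelJacquet1979, §4.6];
[DeitmarEchterhoff2014, Thm. 7.3.2]); the projected class is `K_∞`-finite of the cotangent character, `𝒵`-finite and `𝔭⁻`-annihilated, hence represented by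
a unique analytic cone-holomorphic cotangent form ([Borel1997, Thm. 2.13, §5.14 and §8.4]; [HarishChandra1968]); conjugation exchanges `(1,0)` and `(0,1)`
([BorelWallach2000, VII 2.10]).  Seat F0P5-p03 (g2); crux `HLiu418`, item stmt-HodgeConjecture-24832.  HC_CM is proved only modulo the printed citations
until rung 0 closes; this file discharges none of them.

## References
* [BorelJacquet1979] A. Borel, H. Jacquet, *Automorphic forms and automorphic representations*, Corvallis PSPM 33.1 (1979), §4.6.
* [Borel1997] A. Borel, *Automorphic forms on SL₂(ℝ)*, Cambridge Tracts 130 (1997), Thm. 2.13, §5.13–§5.14, §8.4.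
* [BorelWallach2000] A. Borel, N. Wallach, *Continuous cohomology, discrete subgroups, and representations of reductive groups*, 2nd ed. (2000), VII 2.10.
* [HarishChandra1968] Harish-Chandra, *Automorphic forms on semisimple Lie groups*, LNM 62 (1968).
* [DeitmarEchterhoff2014] A. Deitmar, S. Echterhoff, *Principles of Harmonic Analysis*, 2nd ed. (2014), Thm. 7.3.2.
* [PlatonovRapinchuk1994] V. Platonov, A. Rapinchuk, *Algebraic groups and number theory* (1994), §2.3 (unitary groups of hermitian forms).
-/

noncomputable section

open MeasureTheory NumberField NumberField.InfinitePlace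
open scoped Matrix ComplexOrder

namespace Literature.NumberTheory.Automorphic.UnitaryCurveForms

open Literature.NumberTheory.Automorphic.UnitaryGroup
open Literature.NumberTheory.Automorphic.UnitaryGroup.CotangentForms (toQuotFun)

/-- **(D₂)⁺ applied at hermitian `σ_{w(ι)}H`.**  The conclusion of ★ `holCotFormSpectralProjection₂` for one datum, with its hypotheses explicit and the
hermitian hypothesis `_hH : (H.map (cmPlace L ι).1.embedding).IsHermitian` added after the diagonalisation `hg` (consumed only once the letter carries that
binder; the proof elaborates against both shapes of the letter). [cite: BorelJacquet1979, §4.6] [cite: Borel1997, Thm. 2.13, §5.14 and §8.4]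
[cite: HarishChandra1968] [cite: DeitmarEchterhoff2014, Thm. 7.3.2] [cite: PlatonovRapinchuk1994, §2.3] -/
theorem holCotFormSpectralProjection₂.apply_herm (hD : holCotFormSpectralProjection₂)
    (L : Type) [Field L] [NumberField L] [IsCMField L] (ι : L →+* ℂ) (H : Matrix (Fin 2) (Fin 2) L)
    (dV : Fin 2 → L) (hdV : ∀ i, IsCMField.complexConj L (dV i) = dV i) (hdV0 : ∀ i, dV i ≠ 0)
    (t : L) (ht : t ≠ 0) (g : GL (Fin 2) L)
    (hg : formCongr ((IsCMField.complexConj L : L ≃ₐ[↥(maximalRealSubfield L)] L) : L →+* L) g (t • H) = Matrix.diagonal dV)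
    (_hH : (H.map (cmPlace L ι).1.embedding).IsHermitian)
    (_hsig : ∃ T : GL (Fin 2) ℂ, formCongr (starRingEnd ℂ) T ((Matrix.diagonal dV).map ι) = Matrix.diagonal ![(1 : ℂ), -1])
    (_hpos : ∀ τ' : L →+* ℂ, InfinitePlace.mk τ' ≠ InfinitePlace.mk ι → ((Matrix.diagonal dV).map τ').PosDef)
    (_h4 : 4 ≤ Module.finrank ℚ L)
    (𝔣 : ConeFrame L H (cmPlace L ι))
    (μ : Measure (adelicGroupData (↥(maximalRealSubfield L)) L (IsCMField.complexConj L) 2 H).automorphicQuotient)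
    [(adelicGroupData (↥(maximalRealSubfield L)) L (IsCMField.complexConj L) 2 H).IsAutomorphicMeasure μ]
    (P : DiscreteAutomorphicRep (adelicGroupData (↥(maximalRealSubfield L)) L (IsCMField.complexConj L) 2 H) μ)
    (f : (adelicGroupData (↥(maximalRealSubfield L)) L (IsCMField.complexConj L) 2 H).Adelic → ℂ)
    (_hfmem : f ∈ holCotForms₂ (↥(maximalRealSubfield L)) L (IsCMField.complexConj L) H (IsCMField.complexConj_ne_one L)
          (UnitaryGroup.complexConj_smul_infinitePlace L) (cmPlace L ι) 𝔣)
    (hf : MemLp (toQuotFun (adelicGroupData (↥(maximalRealSubfield L)) L (IsCMField.complexConj L) 2 H) f) 2 μ) :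
      ∃ f' ∈ holCotForms₂ (↥(maximalRealSubfield L)) L (IsCMField.complexConj L) H (IsCMField.complexConj_ne_one L)
          (UnitaryGroup.complexConj_smul_infinitePlace L) (cmPlace L ι) 𝔣,
        ∃ hf' : MemLp (toQuotFun (adelicGroupData (↥(maximalRealSubfield L)) L (IsCMField.complexConj L) 2 H) f') 2 μ,
          P.space.toSubmodule.starProjection
              (MemLp.toLp (toQuotFun (adelicGroupData (↥(maximalRealSubfield L)) L (IsCMField.complexConj L) 2 H) f) hf) =
            MemLp.toLp (toQuotFun (adelicGroupData (↥(maximalRealSubfield L)) L (IsCMField.complexConj L) 2 H) f') hf' := by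
  -- shape-robust: the letter applied up to the diagonalisation; every remaining hypothesis (with or without the hermitian one) is in context
  apply hD L ι H dV hdV hdV0 t ht g hg
  all_goals assumption

/-- **(D₂)⁻ applied at hermitian `σ_{w(ι)}H`.**  The conclusion of ★ `antiholCotFormSpectralProjection₂` for one datum (values in
`(holCotForms₂ … 𝔣).map (conjFun₂ …)`), hypotheses explicit, the hermitian hypothesis added after the diagonalisation; shape-robust proof as for
`holCotFormSpectralProjection₂.apply_herm`. [cite: BorelJacquet1979, §4.6] [cite: Borel1997, Thm. 2.13, §5.14 and §8.4] [cite: HarishChandra1968]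
[cite: BorelWallach2000, VII 2.10] [cite: DeitmarEchterhoff2014, Thm. 7.3.2] [cite: PlatonovRapinchuk1994, §2.3] -/
theorem antiholCotFormSpectralProjection₂.apply_herm (hD' : antiholCotFormSpectralProjection₂)
    (L : Type) [Field L] [NumberField L] [IsCMField L] (ι : L →+* ℂ) (H : Matrix (Fin 2) (Fin 2) L)
    (dV : Fin 2 → L) (hdV : ∀ i, IsCMField.complexConj L (dV i) = dV i) (hdV0 : ∀ i, dV i ≠ 0)
    (t : L) (ht : t ≠ 0) (g : GL (Fin 2) L)
    (hg : formCongr ((IsCMField.complexConj L : L ≃ₐ[↥(maximalRealSubfield L)] L) : L →+* L) g (t • H) = Matrix.diagonal dV)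
    (_hH : (H.map (cmPlace L ι).1.embedding).IsHermitian)
    (_hsig : ∃ T : GL (Fin 2) ℂ, formCongr (starRingEnd ℂ) T ((Matrix.diagonal dV).map ι) = Matrix.diagonal ![(1 : ℂ), -1])
    (_hpos : ∀ τ' : L →+* ℂ, InfinitePlace.mk τ' ≠ InfinitePlace.mk ι → ((Matrix.diagonal dV).map τ').PosDef)
    (_h4 : 4 ≤ Module.finrank ℚ L)
    (𝔣 : ConeFrame L H (cmPlace L ι))
    (μ : Measure (adelicGroupData (↥(maximalRealSubfield L)) L (IsCMField.complexConj L) 2 H).automorphicQuotient)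
    [(adelicGroupData (↥(maximalRealSubfield L)) L (IsCMField.complexConj L) 2 H).IsAutomorphicMeasure μ]
    (P : DiscreteAutomorphicRep (adelicGroupData (↥(maximalRealSubfield L)) L (IsCMField.complexConj L) 2 H) μ)
    (f : (adelicGroupData (↥(maximalRealSubfield L)) L (IsCMField.complexConj L) 2 H).Adelic → ℂ)
    (_hfmem : f ∈ (holCotForms₂ (↥(maximalRealSubfield L)) L (IsCMField.complexConj L) H (IsCMField.complexConj_ne_one L)
          (UnitaryGroup.complexConj_smul_infinitePlace L) (cmPlace L ι) 𝔣).map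
        (conjFun₂ (↥(maximalRealSubfield L)) L (IsCMField.complexConj L) H))
    (hf : MemLp (toQuotFun (adelicGroupData (↥(maximalRealSubfield L)) L (IsCMField.complexConj L) 2 H) f) 2 μ) :
      ∃ f' ∈ (holCotForms₂ (↥(maximalRealSubfield L)) L (IsCMField.complexConj L) H (IsCMField.complexConj_ne_one L)
          (UnitaryGroup.complexConj_smul_infinitePlace L) (cmPlace L ι) 𝔣).map
        (conjFun₂ (↥(maximalRealSubfield L)) L (IsCMField.complexConj L) H),
        ∃ hf' : MemLp (toQuotFun (adelicGroupData (↥(maximalRealSubfield L)) L (IsCMField.complexConj L) 2 H) f') 2 μ,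
          P.space.toSubmodule.starProjection
              (MemLp.toLp (toQuotFun (adelicGroupData (↥(maximalRealSubfield L)) L (IsCMField.complexConj L) 2 H) f) hf) =
            MemLp.toLp (toQuotFun (adelicGroupData (↥(maximalRealSubfield L)) L (IsCMField.complexConj L) 2 H) f') hf' := by
  -- shape-robust, as above
  apply hD' L ι H dV hdV hdV0 t ht g hg
  all_goals assumption

end Literature.NumberTheory.Automorphic.UnitaryCurveForms

end
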